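import Summits.Ventures.CertifiedManyBodySolver.Upper.StripCellHamiltonianTTPrime
import Summits.Ventures.CertifiedManyBodySolver.Upper.StripCellSpinCharge
import Summits.Ventures.CertifiedManyBodySolver.Upper.StripCellRowSum
import HarnessLib

/-!
# The open Hubbard strip in column-major order, IV′: STRUCTURE of the `t–t′` cell bond matrix (producer-free)

HONEST FRAMING: first certified bounds; not a superconductivity verdict; every number certified or
labelled float. NO NUMBER IS CLAIMED HERE.

Venture `Ventures/CertifiedManyBodySolver` (sr-mbsolver), the `t′`-general strip-cell transport theorem (VAR item
V13), PART 4/5 (part 3: `Upper/StripCellHamiltonianTTPrime.lean`; the `t′ = 0` originals: `Upper/StripCellStructure.lean`,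
`Upper/StripCellSpinCharge.lean`, `Upper/StripCellRowSum.lean`). The diagonal inter-cell words move one `τ`-fermion
across the cut exactly like the horizontal ones, so every structural fact of the landed `stripCellBondMatrix` holds
for `stripCellBondMatrixTT' κ hc t t' U`:

* `interCellDiagMatrix_conservesCharge`, **`stripCellBondMatrixTT'_conservesCharge`** (total cell charge);
* `interCellDiagMatrix_conservesSpinCharge`, **`stripCellBondMatrixTT'_conservesSpinCharge`** (`n↑`, `n↓` separately —
  the structural inputs of the two-charge sector lemma `posSemidef_sub_dualMatrix_of_sectors₂`);
* `interCellDiagMatrix_isHermitian`, **`stripCellBondMatrixTT'_isHermitian`**;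
* `rowSum_toSpin_hubbardOpenBoxTT'_le`, `rowSum_interCellDiagMatrix_le`, **`stripCellBondMatrixTT'_rowSum_le`** and the
  row-sum constant **`stripCellRowBoundTT' c W t t' U`** `= |t|·(#nn-darts(c × W)·1 + 4W) + |t′|·(#diag-darts(c × W) +
  4·#adjRowPairs W) + |U|·cW` (Geršgorin input for the Loewner bound `γ·1 ∓ hh ⪰ 0`; closed form in part 5).

Sources: Essler et al. (2005) §12.3.4 (Jordan–Wigner words) [EsslerEtAl2005]; Lieb (1989) Remark (2) (`[H, N_σ] = 0`)
[LiebPRL1989]; Horn–Johnson (2013) Thm. 6.1.1 (Geršgorin) [HornJohnson2013].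
-/

noncomputable section

open Matrix Finset
open scoped ComplexOrder BigOperators Kronecker

namespace Summit.Ventures.CertifiedManyBodySolver.Upper

open Literature.MathematicalPhysics.QuantumLattice
open Literature.MathematicalPhysics.QuantumLattice.JordanWigner

section Structure

variable {c W Q : ℕ}

/-! ### Charge conservation -/

/-- **The diagonal inter-cell coupling conserves the cell charge**: each word moves one fermion across the cut. -/
theorem interCellDiagMatrix_conservesCharge (κ : TensorIndex (Fin c ×ₗ Fin W) 4 ≃ Fin Q) (hc : 0 < c)
    (t' : ℝ) :
    ∀ p p', interCellDiagMatrix κ hc t' p p' ≠ 0 →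
      (cellCharge κ p.1 : ℤ) + cellCharge κ p.2 = cellCharge κ p'.1 + cellCharge κ p'.2 := by
  unfold interCellDiagMatrix
  refine conservesCharge_smul κ (conservesCharge_sum κ _ fun d _ =>
    conservesCharge_sum κ _ fun σ _ => ?_) _
  refine conservesCharge_add κ ?_ ?_
  · refine conservesCharge_kronecker κ (a := 1 + 0) (b := -1)
      (cellShift_superSite_productOp κ _ (toLex (⟨c - 1, by omega⟩, d.1))
        (by rw [interLeftFamily_self]
            exact siteShift_mul (siteShift_siteCreation σ) siteShift_siteParity)
        fun f hf => siteShift_of_eq_siteParity_or_one (interLeftFamily_of_ne hc d.1 _ hf))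
      (cellShift_superSite_productOp κ _ (toLex (⟨0, hc⟩, d.2))
        (by rw [interRightFamily_self]; exact siteShift_siteAnnihilation σ)
        fun f hf => siteShift_of_eq_siteParity_or_one (interRightFamily_of_ne hc d.2 _ hf)) (by norm_num)
  · refine conservesCharge_kronecker κ (a := 0 + -1) (b := 1)
      (cellShift_superSite_productOp κ _ (toLex (⟨c - 1, by omega⟩, d.1))
        (by rw [interLeftFamily_self]
            exact siteShift_mul siteShift_siteParity (siteShift_siteAnnihilation σ))
        fun f hf => siteShift_of_eq_siteParity_or_one (interLeftFamily_of_ne hc d.1 _ hf))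
      (cellShift_superSite_productOp κ _ (toLex (⟨0, hc⟩, d.2))
        (by rw [interRightFamily_self]; exact siteShift_siteCreation σ)
        fun f hf => siteShift_of_eq_siteParity_or_one (interRightFamily_of_ne hc d.2 _ hf)) (by norm_num)

/-- **The `t–t′` cell bond matrix conserves the cell charge.** -/
theorem stripCellBondMatrixTT'_conservesCharge (κ : TensorIndex (Fin c ×ₗ Fin W) 4 ≃ Fin Q) (hc : 0 < c)
    (t t' U : ℝ) :
    ∀ p p', stripCellBondMatrixTT' κ hc t t' U p p' ≠ 0 →
      (cellCharge κ p.1 : ℤ) + cellCharge κ p.2 = cellCharge κ p'.1 + cellCharge κ p'.2 := by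
  unfold stripCellBondMatrixTT'
  exact conservesCharge_add κ (conservesCharge_add κ (conservesCharge_kronecker κ
    (cellShift_superSite_toSpin_hubbardOpenBoxTT' κ t t' U) (cellShift_one κ) (by norm_num))
    (interCellMatrix_conservesCharge κ hc t)) (interCellDiagMatrix_conservesCharge κ hc t')

/-- **The diagonal inter-cell coupling conserves the spin-resolved cell charge**: each word moves one `τ`-fermion
across the cut. [cite: EsslerEtAl2005, §12.3.4] -/
theorem interCellDiagMatrix_conservesSpinCharge (κ : TensorIndex (Fin c ×ₗ Fin W) 4 ≃ Fin Q) (hc : 0 < c)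
    (t' : ℝ) (σ : Fin 2) :
    ∀ p p', interCellDiagMatrix κ hc t' p p' ≠ 0 →
      (cellSpinCharge κ σ p.1 : ℤ) + cellSpinCharge κ σ p.2 =
        cellSpinCharge κ σ p'.1 + cellSpinCharge κ σ p'.2 := by
  unfold interCellDiagMatrix cellSpinCharge
  refine conservesFn_smul κ _ (conservesFn_sum κ _ _ fun d _ =>
    conservesFn_sum κ _ _ fun τ _ => ?_) _
  refine conservesFn_add κ _ ?_ ?_
  · refine conservesFn_kronecker κ _ (a := (if σ = τ then (1 : ℤ) else 0) + 0)
      (b := -(if σ = τ then (1 : ℤ) else 0))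
      (cellFnShift_superSite_productOp κ _ _ (toLex (⟨c - 1, by omega⟩, d.1))
        (by rw [interLeftFamily_self]
            exact siteFnShift_mul _ (siteSpinShift_siteCreation σ τ) (siteFnShift_siteParity _))
        fun f hf => siteFnShift_of_eq_siteParity_or_one _ (interLeftFamily_of_ne hc d.1 _ hf))
      (cellFnShift_superSite_productOp κ _ _ (toLex (⟨0, hc⟩, d.2))
        (by rw [interRightFamily_self]; exact siteSpinShift_siteAnnihilation σ τ)
        fun f hf => siteFnShift_of_eq_siteParity_or_one _ (interRightFamily_of_ne hc d.2 _ hf)) (by ring)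
  · refine conservesFn_kronecker κ _ (a := 0 + -(if σ = τ then (1 : ℤ) else 0))
      (b := (if σ = τ then (1 : ℤ) else 0))
      (cellFnShift_superSite_productOp κ _ _ (toLex (⟨c - 1, by omega⟩, d.1))
        (by rw [interLeftFamily_self]
            exact siteFnShift_mul _ (siteFnShift_siteParity _) (siteSpinShift_siteAnnihilation σ τ))
        fun f hf => siteFnShift_of_eq_siteParity_or_one _ (interLeftFamily_of_ne hc d.1 _ hf))
      (cellFnShift_superSite_productOp κ _ _ (toLex (⟨0, hc⟩, d.2))
        (by rw [interRightFamily_self]; exact siteSpinShift_siteCreation σ τ)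
        fun f hf => siteFnShift_of_eq_siteParity_or_one _ (interRightFamily_of_ne hc d.2 _ hf)) (by ring)

/-- **The `t–t′` cell bond matrix conserves the spin-resolved cell charge** (`σ = ↑, ↓` separately).
[cite: LiebPRL1989, Remark (2)] -/
theorem stripCellBondMatrixTT'_conservesSpinCharge (κ : TensorIndex (Fin c ×ₗ Fin W) 4 ≃ Fin Q) (hc : 0 < c)
    (t t' U : ℝ) (σ : Fin 2) :
    ∀ p p', stripCellBondMatrixTT' κ hc t t' U p p' ≠ 0 →
      (cellSpinCharge κ σ p.1 : ℤ) + cellSpinCharge κ σ p.2 =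
        cellSpinCharge κ σ p'.1 + cellSpinCharge κ σ p'.2 := by
  unfold stripCellBondMatrixTT'
  have h1 := cellSpinShift_superSite_toSpin_hubbardOpenBoxTT' κ t t' U σ
  have h2 := cellFnShift_one κ (siteSpinCharge σ)
  have h3 := interCellMatrix_conservesSpinCharge κ hc t σ
  have h4 := interCellDiagMatrix_conservesSpinCharge κ hc t' σ
  unfold cellSpinCharge at h1 h3 h4 ⊢
  exact conservesFn_add κ _ (conservesFn_add κ _ (conservesFn_kronecker κ _ h1 h2 (by norm_num)) h3) h4

/-! ### Hermiticity -/

/-- **The diagonal inter-cell coupling is Hermitian** (the two words of each bond are each other's adjoints). -/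
theorem interCellDiagMatrix_isHermitian (κ : TensorIndex (Fin c ×ₗ Fin W) 4 ≃ Fin Q) (hc : 0 < c) (t' : ℝ) :
    (interCellDiagMatrix κ hc t').IsHermitian := by
  have hterm : ∀ (d : Fin W × Fin W) (σ : Fin 2),
      (superSite κ (productOp (interLeftFamily hc d.1 (siteCreation σ * siteParity))) ⊗ₖ
          superSite κ (productOp (interRightFamily hc d.2 (siteAnnihilation σ))) +
        superSite κ (productOp (interLeftFamily hc d.1 (siteParity * siteAnnihilation σ))) ⊗ₖ
          superSite κ (productOp (interRightFamily hc d.2 (siteCreation σ))))ᴴ =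
      superSite κ (productOp (interLeftFamily hc d.1 (siteCreation σ * siteParity))) ⊗ₖ
          superSite κ (productOp (interRightFamily hc d.2 (siteAnnihilation σ))) +
        superSite κ (productOp (interLeftFamily hc d.1 (siteParity * siteAnnihilation σ))) ⊗ₖ
          superSite κ (productOp (interRightFamily hc d.2 (siteCreation σ))) := by
    intro d σ
    rw [conjTranspose_add, conjTranspose_kronecker, conjTranspose_kronecker,
      superSite_productOp_conjTranspose, superSite_productOp_conjTranspose,
      superSite_productOp_conjTranspose, superSite_productOp_conjTranspose,
      interLeftFamily_conjTranspose, interLeftFamily_conjTranspose, interRightFamily_conjTranspose,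
      interRightFamily_conjTranspose, conjTranspose_siteCreation_mul_siteParity,
      conjTranspose_siteAnnihilation, conjTranspose_siteParity_mul_siteAnnihilation,
      conjTranspose_siteCreation, add_comm]
  unfold interCellDiagMatrix Matrix.IsHermitian
  rw [conjTranspose_smul, conjTranspose_sum]
  simp_rw [conjTranspose_sum, hterm]
  congr 1
  rw [star_neg, Complex.star_def, Complex.conj_ofReal]

/-- **The `t–t′` cell bond matrix is Hermitian.** -/
theorem stripCellBondMatrixTT'_isHermitian (κ : TensorIndex (Fin c ×ₗ Fin W) 4 ≃ Fin Q) (hc : 0 < c)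
    (t t' U : ℝ) : (stripCellBondMatrixTT' κ hc t t' U).IsHermitian := by
  have hA : (superSite κ (JordanWigner.toSpin (hubbardOpenBoxTT' c W t t' U))).IsHermitian := by
    rw [Matrix.IsHermitian, ← superSite_conjTranspose, ← toSpin_conjTranspose,
      (hubbardOpenBoxTT'_isHermitian c W t t' U).eq]
  have h1 : (superSite κ (JordanWigner.toSpin (hubbardOpenBoxTT' c W t t' U)) ⊗ₖ
      (1 : Matrix (Fin Q) (Fin Q) ℂ)).IsHermitian := by
    rw [Matrix.IsHermitian, conjTranspose_kronecker, conjTranspose_one, hA.eq]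
  unfold stripCellBondMatrixTT'
  exact (h1.add (interCellMatrix_isHermitian κ hc t)).add (interCellDiagMatrix_isHermitian κ hc t')

/-! ### Row sums -/

/-- **Row sums of the Jordan–Wigner image of the `t–t′` cell Hamiltonian**:
`≤ |t|·#{nn darts} + |t′|·#{diagonal darts} + |U|·(c·W)` (dart = ordered adjacent pair, counted twice for spin). -/
theorem rowSum_toSpin_hubbardOpenBoxTT'_le (c W : ℕ) (t t' U : ℝ) :
    ∀ σ, ∑ τ, ‖toSpin (hubbardOpenBoxTT' c W t t' U) σ τ‖ ≤
      |t| * (∑ f : Fin c ×ₗ Fin W, ∑ f' : Fin c ×ₗ Fin W, if (rectBoxGraph c W).Adj f f' then (2 : ℝ) else 0) +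
        |t'| * (∑ f : Fin c ×ₗ Fin W, ∑ f' : Fin c ×ₗ Fin W,
          if (rectBoxDiagGraph c W).Adj f f' then (2 : ℝ) else 0) + |U| * (c * W) := by
  intro σ
  rw [hubbardOpenBoxTT', map_add]
  have h1 := rowSum_toSpin_hamiltonian_le (rectBoxGraph c W) t U
  have h2 := rowSum_toSpin_hamiltonian_le (rectBoxDiagGraph c W) t' 0
  have hcard : (Fintype.card (Fin c ×ₗ Fin W) : ℝ) = c * W := by
    rw [Fintype.card_lex, Fintype.card_prod, Fintype.card_fin, Fintype.card_fin, Nat.cast_mul]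
  rw [hcard] at h1 h2
  simp only [abs_zero, zero_mul, add_zero] at h2
  have h := rowSum_add_le _ _ h1 h2 σ
  linarith

/-- **Row sums of the diagonal inter-cell coupling**: `#adjRowPairs W` bonds, four half-word pairs each, every one a
Kronecker product of two row-contractions ⇒ `≤ |t′|·4·#adjRowPairs W`. [folklore] -/
theorem rowSum_interCellDiagMatrix_le (κ : TensorIndex (Fin c ×ₗ Fin W) 4 ≃ Fin Q) (hc : 0 < c) (t' : ℝ) :
    ∀ p, ∑ p', ‖interCellDiagMatrix κ hc t' p p'‖ ≤ |t'| * (4 * (adjRowPairs W).card) := by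
  have hpair : ∀ (u v : (Fin c ×ₗ Fin W) → Matrix (Fin 4) (Fin 4) ℂ),
      (∀ f a, ∑ b, ‖u f a b‖ ≤ 1) → (∀ f a, ∑ b, ‖v f a b‖ ≤ 1) →
      ∀ p : Fin Q × Fin Q, ∑ p', ‖(superSite κ (productOp u) ⊗ₖ superSite κ (productOp v)) p p'‖ ≤ 1 := by
    intro u v hu hv p
    obtain ⟨S, S'⟩ := p
    rw [rowSum_kronecker, rowSum_superSite, rowSum_superSite]
    calc (∑ τ, ‖productOp u (κ.symm S) τ‖) * ∑ τ, ‖productOp v (κ.symm S') τ‖ ≤ 1 * 1 :=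
          mul_le_mul (rowSum_productOp_le_one u hu _) (rowSum_productOp_le_one v hv _)
            (Finset.sum_nonneg fun _ _ => norm_nonneg _) zero_le_one
      _ = 1 := one_mul 1
  have hsum : ∀ p, ∑ p', ‖(∑ d ∈ adjRowPairs W, ∑ σ : Fin 2,
      (superSite κ (productOp (interLeftFamily hc d.1 (siteCreation σ * siteParity))) ⊗ₖ
          superSite κ (productOp (interRightFamily hc d.2 (siteAnnihilation σ))) +
        superSite κ (productOp (interLeftFamily hc d.1 (siteParity * siteAnnihilation σ))) ⊗ₖ
          superSite κ (productOp (interRightFamily hc d.2 (siteCreation σ))))) p p'‖ ≤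
      ∑ _d ∈ adjRowPairs W, ∑ _σ : Fin 2, ((1 : ℝ) + 1) := by
    refine rowSum_sum_le _ _ fun d _ => rowSum_sum_le _ _ fun σ _ => rowSum_add_le _ _ ?_ ?_
    · refine hpair _ _ (rowSum_interLeftFamily_le_one hc d.1 ?_)
        (rowSum_interRightFamily_le_one hc d.2 (rowSum_siteAnnihilation_le_one σ))
      simpa only [one_mul] using
        rowSum_mul_le _ _ zero_le_one (rowSum_siteCreation_le_one σ) rowSum_siteParity_le_one
    · refine hpair _ _ (rowSum_interLeftFamily_le_one hc d.1 ?_)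
        (rowSum_interRightFamily_le_one hc d.2 (rowSum_siteCreation_le_one σ))
      simpa only [one_mul] using
        rowSum_mul_le _ _ zero_le_one rowSum_siteParity_le_one (rowSum_siteAnnihilation_le_one σ)
  intro p
  unfold interCellDiagMatrix
  have h := rowSum_smul_le _ (-(t' : ℂ)) hsum p
  have ht : ‖(-(t' : ℂ))‖ = |t'| := by rw [norm_neg, Complex.norm_real, Real.norm_eq_abs]
  have hW : (∑ _d ∈ adjRowPairs W, ∑ _σ : Fin 2, ((1 : ℝ) + 1)) = 4 * (adjRowPairs W).card := by
    simp only [Finset.sum_const, Finset.card_univ, Fintype.card_fin]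
    ring
  rw [ht, hW] at h
  exact h

/-- **The row-sum constant of the `t–t′` strip cell bond matrix**:
`|t|·(#{nn darts of the c × W box} + 4W) + |t′|·(#{diagonal darts of the c × W box} + 4·#adjRowPairs W) + |U|·(c·W)`
(closed form `|t|·(4((c−1)W + c(W−1)) + 4W) + |t′|·(8(c−1)(W−1) + 8(W−1)) + |U|·cW` in part 5). -/
def stripCellRowBoundTT' (c W : ℕ) (t t' U : ℝ) : ℝ :=
  |t| * ((∑ f : Fin c ×ₗ Fin W, ∑ f' : Fin c ×ₗ Fin W, if (rectBoxGraph c W).Adj f f' then (2 : ℝ) else 0) +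
      4 * W) +
    |t'| * ((∑ f : Fin c ×ₗ Fin W, ∑ f' : Fin c ×ₗ Fin W,
        if (rectBoxDiagGraph c W).Adj f f' then (2 : ℝ) else 0) + 4 * (adjRowPairs W).card) +
    |U| * (c * W)

/-- **Row sums of the `t–t′` strip cell bond matrix** `hh = superSite κ (toSpin H_cell) ⊗ 1 + interCellMatrix +
interCellDiagMatrix`: `Σ_{p'} |hh p p'| ≤ stripCellRowBoundTT' c W t t' U`. PRODUCER-FREE: with
`stripCellBondMatrixTT'_isHermitian` it discharges the Loewner inputs `γ·1 ∓ hh ⪰ 0` of Lemma P. [folklore] -/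
theorem stripCellBondMatrixTT'_rowSum_le (κ : TensorIndex (Fin c ×ₗ Fin W) 4 ≃ Fin Q) (hc : 0 < c)
    (t t' U : ℝ) :
    ∀ p, ∑ p', ‖stripCellBondMatrixTT' κ hc t t' U p p'‖ ≤ stripCellRowBoundTT' c W t t' U := by
  intro p
  obtain ⟨S, S'⟩ := p
  unfold stripCellBondMatrixTT' stripCellRowBoundTT'
  have hintra : ∀ pp : Fin Q × Fin Q, ∑ p', ‖(superSite κ (toSpin (hubbardOpenBoxTT' c W t t' U)) ⊗ₖ
      (1 : Matrix (Fin Q) (Fin Q) ℂ)) pp p'‖ ≤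
      |t| * (∑ f : Fin c ×ₗ Fin W, ∑ f' : Fin c ×ₗ Fin W, if (rectBoxGraph c W).Adj f f' then (2 : ℝ) else 0) +
        |t'| * (∑ f : Fin c ×ₗ Fin W, ∑ f' : Fin c ×ₗ Fin W,
          if (rectBoxDiagGraph c W).Adj f f' then (2 : ℝ) else 0) + |U| * (c * W) := by
    intro pp
    obtain ⟨T, T'⟩ := pp
    rw [rowSum_kronecker, rowSum_superSite]
    have h1 := rowSum_toSpin_hubbardOpenBoxTT'_le c W t t' U (κ.symm T)
    calc (∑ τ, ‖toSpin (hubbardOpenBoxTT' c W t t' U) (κ.symm T) τ‖) *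
          ∑ j', ‖(1 : Matrix (Fin Q) (Fin Q) ℂ) T' j'‖ ≤
        (|t| * (∑ f : Fin c ×ₗ Fin W, ∑ f' : Fin c ×ₗ Fin W,
          if (rectBoxGraph c W).Adj f f' then (2 : ℝ) else 0) +
          |t'| * (∑ f : Fin c ×ₗ Fin W, ∑ f' : Fin c ×ₗ Fin W,
            if (rectBoxDiagGraph c W).Adj f f' then (2 : ℝ) else 0) + |U| * (c * W)) * 1 :=
          mul_le_mul h1 (rowSum_one_le_one T') (Finset.sum_nonneg fun _ _ => norm_nonneg _)
            ((Finset.sum_nonneg fun _ _ => norm_nonneg _).trans h1)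
      _ = _ := mul_one _
  have h := rowSum_add_le _ _ (rowSum_add_le _ _ hintra (rowSum_interCellMatrix_le κ hc t))
    (rowSum_interCellDiagMatrix_le κ hc t') (S, S')
  linarith

end Structure

end Summit.Ventures.CertifiedManyBodySolver.Upper

end
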